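import Summits.Schanuel.Schanuel.Theorems.ZilberEacDiagonalCriticalExistence
import HarnessLib

/-!
# The cancelling fixed point: `e^{x} = x + w` with `e^{x}` negligible

Zilber's Exponential-Algebraic Closedness, case ladder (host summit Schanuel, cell `pub-schanuel`,
seat 2, gen 15).  The fibre equations of the cell's 3-folds are `e^{xⱼ} = xⱼ + wⱼ` with
`wⱼ = y₂Fⱼ(y₂)` large.  Besides the slow (`e^{x} ≈ x`), fast (`e^{x} ≈ w`) and critical balances,
there is the CANCELLING solution `x ≈ −w` in which `e^{x}` is negligible: writing `x = −w + δ` the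
equation is `δ = e^{−w}e^{δ}`, i.e. the fixed point `δ = εe^{δ}` with the small parameter
`ε = e^{−w}` — an implicit-function problem at `(ε, δ) = (0, 0)` with derivative `1`.  This is the
mechanism behind `ZilberEacCancellingFibreExistence` (where it is folded into the two-fibre system)
and the building block of the planned double-cancelling regime (HANDOFF O59 PLAN), in which BOTH
fibres cancel and `ε = e^{−w}` is super-exponentially small along the family.

* **`exists_cancellingFixedPoint`** — `ψ` with `ψ(ε) → 0`, `ψ(ε) = εe^{ψ(ε)}` and `‖ψ(ε)‖ ≤ 2‖ε‖`
  for all small `ε`, and `e^{x} = x + w` for `x = −w + ψ(e^{−w})` whenever `e^{−w}` is small.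

HONEST FRAMING: an elementary existence lemma serving explicit families inside the OPEN cell
`EC(3,2)`; NOT Schanuel's conjecture; EAC ⇏ SC.
-/

noncomputable section

open Complex Filter Topology

set_option linter.dupNamespace false

namespace Summit.Schanuel.Schanuel.Theorems

section CancellingFixedPoint

/-- **The cancelling fixed point.**  There is `ψ : ℂ → ℂ` with `ψ(ε) → 0` as `ε → 0`,
`ψ(ε) = εe^{ψ(ε)}` and `‖ψ(ε)‖ ≤ 2‖ε‖` for all small `ε`, and consequently
`e^{−w + ψ(e^{−w})} = (−w + ψ(e^{−w})) + w` whenever `e^{−w}` is small enough. (new) -/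
theorem exists_cancellingFixedPoint :
    ∃ ψ : ℂ → ℂ, Tendsto ψ (𝓝 0) (𝓝 0) ∧ (∀ᶠ ε in 𝓝 0, ψ ε = ε * exp (ψ ε)) ∧
      (∀ᶠ ε in 𝓝 0, ‖ψ ε‖ ≤ 2 * ‖ε‖) ∧
      ∀ᶠ ε in 𝓝 (0 : ℂ), ∀ w : ℂ, exp (-w) = ε → exp (-w + ψ ε) = (-w + ψ ε) + w := by
  set f : ℂ × ℂ → ℂ := fun q => q.2 - q.1 * exp q.2 with hf
  have hfC : ContDiff ℂ 1 f := by
    rw [hf]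
    fun_prop
  have hfq : f (0, 0) = 0 := by simp [hf]
  have hL : HasFDerivAt (fun q' : ℂ => f (0, q')) (ContinuousLinearMap.id ℂ ℂ) 0 := by
    have : (fun q' : ℂ => f (0, q')) = fun q' => q' := by
      funext q'
      simp [hf]
    rw [this]
    exact hasFDerivAt_id 0
  have hinj : Function.Injective (ContinuousLinearMap.id ℂ ℂ) := fun a b h => by simpa using h
  obtain ⟨ψ, hsol, hlim⟩ := exists_implicit_of_injective_partial hfC hfq hL hinj
  have hfix : ∀ᶠ ε in 𝓝 (0 : ℂ), ψ ε = ε * exp (ψ ε) := by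
    filter_upwards [hsol] with ε hε
    simp only [hf] at hε
    exact sub_eq_zero.1 hε
  refine ⟨ψ, hlim, hfix, ?_, ?_⟩
  · -- `‖e^{ψ}‖ ≤ 2` near `0`
    have hsmall : ∀ᶠ ε in 𝓝 (0 : ℂ), ‖ψ ε‖ < Real.log 2 :=
      (tendsto_zero_iff_norm_tendsto_zero.1 hlim).eventually
        (gt_mem_nhds (Real.log_pos one_lt_two))
    filter_upwards [hfix, hsmall] with ε hε hs
    have hexp : ‖exp (ψ ε)‖ ≤ 2 := by
      rw [Complex.norm_exp]
      calc Real.exp (ψ ε).re ≤ Real.exp (Real.log 2) :=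
            Real.exp_le_exp.2 ((Complex.re_le_norm _).trans hs.le)
        _ = 2 := Real.exp_log two_pos
    calc ‖ψ ε‖ = ‖ε‖ * ‖exp (ψ ε)‖ := by rw [hε, norm_mul]; rw [← hε]
      _ ≤ ‖ε‖ * 2 := mul_le_mul_of_nonneg_left hexp (norm_nonneg _)
      _ = 2 * ‖ε‖ := by ring
  · filter_upwards [hfix] with ε hε w hw
    have : (-w + ψ ε) + w = ψ ε := by ring
    rw [this, Complex.exp_add, hw]
    exact hε.symm

end CancellingFixedPoint

end Summit.Schanuel.Schanuel.Theorems

end
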